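import Literature.NumberTheory.NumberFields.HilbertTheorem94
import Literature.NumberTheory.NumberFields.HilbertClassFieldArtinIsomorphism
import Literature.NumberTheory.NumberFields.HilbertClassFieldRealPlaces
import HarnessLib

/-!
# The principal ideal theorem for number fields with cyclic class group: every ideal of `K` becomes
# principal in the Hilbert class field (from Hilbert's Theorem 94)

Topic `NumberTheory/NumberFields`.  Theorem-only file (no definition, no named fact), unconditional.
The **principal ideal theorem** (Hauptidealsatz; conjectured by Hilbert, proved by Furtwängler 1930 via
Artin's reduction to the group-theoretic transfer): every ideal of a number field `K` becomes principal
in the Hilbert class field `H_K` (Neukirch, *Algebraic Number Theory*, Ch. VI §7 Thm. (7.5)).  For a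
number field whose class group is CYCLIC the theorem is an immediate consequence of Hilbert's Theorem 94
in the exact form of the tree (`HilbertTheorem94.finrank_dvd_card_ker_classGroupExtend`:
`[L : K] ∣ #ker(Cl_K → Cl_L)` for `L/K` cyclic unramified at all places): `H_K/K` is abelian with
`Gal(H_K/K) ≅ Cl_K` (`hilbertClassField.artinEquiv`), hence cyclic, unramified at all places
(`hilbertClassField.isUnramifiedIn`, `hilbertClassField.isUnramifiedAtInfinitePlaces`) of degree `h_K`
(`hilbertClassField.finrank_eq_card_classGroup`), so `h_K ∣ #ker(Cl_K → Cl_{H_K}) ∣ h_K` and the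
capitulation kernel is all of `Cl_K` (this is how Hilbert's Satz 94 yields the Hauptidealsatz for `h_K`
prime, the case that motivated the conjecture).

* `PrincipalIdealTheorem.ker_classGroupExtend_hilbertClassField_eq_top` — **for `Cl_K` cyclic the
  capitulation kernel of `K` in its Hilbert class field is all of `Cl_K`**;
* `PrincipalIdealTheorem.classGroupExtend_hilbertClassField_eq_one` — `i_{H_K/K}(c) = 1` for every
  class `c`;
* `PrincipalIdealTheorem.isPrincipal_map_hilbertClassField` — **every ideal `𝔞` of `𝓞_K` becomes
  principal in `𝓞_{H_K}`** (`Cl_K` cyclic), in particular whenever `h_K` is prime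
  (`…_of_prime_classNumber`).

The general principal ideal theorem (arbitrary `Cl_K`) needs the transfer `Ver : G/G' → G'/G''` and is
not attempted here.

## References

* J. Neukirch, *Algebraic Number Theory* (1999), Ch. VI §7 Thm. (7.5) (principal ideal theorem).
  [NeukirchANT1999]
* D. Hilbert, *Die Theorie der algebraischen Zahlkörper* (1897), Satz 94. [Hilbert1897]
* M. Rosen, *Remarks on the history of Fermat's last theorem 1844 to 1984* (1997), Appendix, Thm. A2.
  [Rosen1997FLT]
* D. A. Cox, *Primes of the form x² + ny²*, 2nd ed. (2013), §5.C Thm. 5.23, §8.A Thm. 8.10. [Cox2013]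
-/

noncomputable section

open NumberField IsDedekindDomain

namespace Literature.NumberTheory.NumberFields

namespace PrincipalIdealTheorem

variable (K : Type) [Field K] [NumberField K]

/-- The Galois group of the Hilbert class field is cyclic when the class group is
(`Gal(H_K/K) ≅ Cl_K`, Artin). [cite: Cox2013, §5.C Thm. 5.23] -/
theorem isCyclic_gal_hilbertClassField [IsCyclic (ClassGroup (𝓞 K))] :
    IsCyclic (hilbertClassField K ≃ₐ[K] hilbertClassField K) :=
  isCyclic_of_surjective (hilbertClassField.artinEquiv K).toMonoidHom
    (hilbertClassField.artinEquiv K).surjective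

/-- **The capitulation kernel of `K` in its Hilbert class field is all of `Cl_K` when `Cl_K` is cyclic**:
`H_K/K` is then cyclic of degree `h_K`, unramified at all places, so by Hilbert's Theorem 94
`h_K ∣ #ker(Cl_K → Cl_{H_K})`, while the kernel is a subgroup of `Cl_K`.
[cite: NeukirchANT1999, Ch. VI §7 Thm. (7.5) (cyclic class group)] [cite: Hilbert1897, Satz 94] -/
theorem ker_classGroupExtend_hilbertClassField_eq_top [IsCyclic (ClassGroup (𝓞 K))] :
    (classGroupExtend K (hilbertClassField K)).ker = ⊤ := by
  classical
  haveI := isCyclic_gal_hilbertClassField K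
  have hdvd := HilbertTheorem94.finrank_dvd_card_ker_classGroupExtend K (hilbertClassField K)
    (hilbertClassField.isUnramifiedIn K)
  rw [hilbertClassField.finrank_eq_card_classGroup, ← Nat.card_eq_fintype_card] at hdvd
  refine Subgroup.eq_top_of_card_eq _ (Nat.dvd_antisymm (Subgroup.card_subgroup_dvd_card _) hdvd)

/-- **Principal ideal theorem, cyclic class group, class form**: `i_{H_K/K}(c) = 1` for every ideal
class `c` of `K`. [cite: NeukirchANT1999, Ch. VI §7 Thm. (7.5) (cyclic class group)] -/
theorem classGroupExtend_hilbertClassField_eq_one [IsCyclic (ClassGroup (𝓞 K))]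
    (c : ClassGroup (𝓞 K)) : classGroupExtend K (hilbertClassField K) c = 1 := by
  have h : c ∈ (classGroupExtend K (hilbertClassField K)).ker := by
    rw [ker_classGroupExtend_hilbertClassField_eq_top]; exact Subgroup.mem_top c
  exact h

/-- **PRINCIPAL IDEAL THEOREM for number fields with cyclic class group**: every ideal `𝔞` of `𝓞_K`
becomes principal in the ring of integers of the Hilbert class field `H_K`.
[cite: NeukirchANT1999, Ch. VI §7 Thm. (7.5) (cyclic class group)] [cite: Hilbert1897, Satz 94] -/
theorem isPrincipal_map_hilbertClassField [IsCyclic (ClassGroup (𝓞 K))] (𝔞 : Ideal (𝓞 K)) :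
    (𝔞.map (algebraMap (𝓞 K) (𝓞 (hilbertClassField K)))).IsPrincipal := by
  classical
  by_cases h𝔞 : 𝔞 = ⊥
  · rw [h𝔞, Ideal.map_bot]; exact bot_isPrincipal
  have h := classGroupExtend_hilbertClassField_eq_one K
    (ClassGroup.mk0 ⟨𝔞, mem_nonZeroDivisors_of_ne_zero h𝔞⟩)
  rw [classGroupExtend_mk0, ClassGroup.mk0_eq_one_iff] at h
  exact h

/-- **Principal ideal theorem for prime class number**: if `h_K` is prime (so `Cl_K` is cyclic), every
ideal of `𝓞_K` becomes principal in the Hilbert class field — the case of Hilbert's Satz 94 with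
`[H_K : K] = h_K = ℓ`. [cite: Hilbert1897, Satz 94] [cite: NeukirchANT1999, Ch. VI §7 Thm. (7.5)] -/
theorem isPrincipal_map_hilbertClassField_of_prime_classNumber (hp : (classNumber K).Prime)
    (𝔞 : Ideal (𝓞 K)) : (𝔞.map (algebraMap (𝓞 K) (𝓞 (hilbertClassField K)))).IsPrincipal := by
  classical
  haveI : Fact (Nat.card (ClassGroup (𝓞 K))).Prime := ⟨by rw [Nat.card_eq_fintype_card]; exact hp⟩
  haveI : IsCyclic (ClassGroup (𝓞 K)) := isCyclic_of_prime_card (p := Nat.card (ClassGroup (𝓞 K))) rfl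
  exact isPrincipal_map_hilbertClassField K 𝔞

end PrincipalIdealTheorem

end Literature.NumberTheory.NumberFields

end
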